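/-
Copyright: the b2b-balaban cell (near-miss cell 7), T⁴-continuum CRUX team (coordinator ruling e34b3e0c item (2)),
seat t4-ne7b-formalise-leaf-06 (gen 29). Released under the licence of the surrounding project.
-/
import Summits.QuantumFields.BalabanUV.T4Continuum.Spine.NE7b.LinkMinimiserEL
import Summits.QuantumFields.BalabanUV.T4Continuum.Spine.NE7b.SU2QuaternionBridge
import Literature.MathematicalPhysics.QuantumLattice.SU2HaarSmallBall
import Literature.Geometry.GaugeTheory.SpinorAlgebraFour

/-!
# The lattice Yang–Mills equation at a link, `SU(2)` side ↔ quaternion side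
# (route NE7b R-H; referee `t4/formal/NE7b/REFEREE.md` pass 49, open item OI-61)

Cell `pub-balaban`, sub-cell `t4`, spine estimate NE7b (node U5c). The sine-curvature chain of route R-H
(`CovariantDivergenceEL`, `CovariantMeanValueInequality`, `SineCurvatureMaximumPrinciple`, `EnergyQuantumLemma`,
`EnergyDichotomy(Z4)`, …) is typed over unit-quaternion configurations `ZdGaugeConfig d S³`, and its criticality
hypothesis is `covDiv V x i = 0` — the vanishing of the covariant lattice divergence of the sine-curvature at the link
`(x,i)` (`CovariantDivergenceEL.critical_iff_covDiv_eq_zero`: ⇔ criticality of the Wilson functional through the link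
along every tangent direction of `S³`). `EnergyDichotomySU2` (p258376) transports (L1) to the cell's
`SU2 = Matrix.specialUnitaryGroup (Fin 2) ℂ` configurations through `SU2QuaternionBridge.toSphereConfig`, but states the
criticality hypothesis as `covDiv (toSphereConfig U) x i = 0`, i.e. on the quaternion side. The row referee (pass 49,
OI-61) asks for the BY-NAME bridge `covDiv (toSphereConfig U) x i = 0 ↔ <SU(2) Euler–Lagrange condition>`.

THIS FILE supplies it, in three equivalent `SU(2)`-side forms and two sufficient ones (law-free algebra ∕ calculus on
ONE configuration `U : ZdGaugeConfig d SU(2)`; link `b = (x,i)`, `S_b :=` **`stapleSU2 U x i`** the `2 × 2` complex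
MATRIX staple sum `Σ_{k ≠ i} [U(x+eᵢ,k) U(x+e_k,i)⁻¹ U(x,k)⁻¹ + U(x+eᵢ−e_k,k)⁻¹ U(x−e_k,i)⁻¹ U(x−e_k,k)]`):

* §3 **`covDiv_toSphereConfig_eq_zero_iff_isHermitian`**: `covDiv (toSphereConfig U) x i = 0 ↔ (U_b·S_b)ᴴ = U_b·S_b`
  — the MATRIX form of the lattice Yang–Mills equation at the link (for `SU(2)` the traceless-antihermitian part of
  `U_b S_b` vanishes iff `U_b S_b` is Hermitian: `U_b S_b` lies in the real span of `SU(2)`, whose antihermitian part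
  is automatically traceless);
* §3 **`covDiv_toSphereConfig_eq_zero_iff_tangent`**: `… ↔ ∀ X, Xᴴ = −X → tr X = 0 → Re tr(X·U_b·S_b) = 0` — the
  TANGENT form (first variation along every direction of `𝔰𝔲(2)·U_b`; `Re tr(V·S_b)` is, up to the factor `½` and an
  additive constant, the Wilson action's dependence on the link variable `V`, `actionThroughSU2_update`);
* §4 **`covDiv_toSphereConfig_eq_zero_of_forall_actionThroughSU2_le`**: a GLOBAL one-link minimiser of the `SU(2)`
  Wilson action **`actionThroughSU2 U x i`** `= Σ_{k ≠ i} [(1 − ½ Re tr P_{ik}(x)) + (1 − ½ Re tr P_{ik}(x − e_k))]`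
  (the other links frozen) satisfies the equation; **`covDiv_toSphereConfig_eq_zero_of_isLocalMin`**: so does a LOCAL
  one, on the topological group `SU(2)` — through leaf-05's `LinkMinimiserEL` BY NAME, transported along the
  homeomorphism `su2SphereEquiv : SU(2) ≃* S³` (`continuous_su2SphereEquiv`, `continuous_su2SphereEquiv_symm`).

Dictionary on the way (§2): `quatMatrix (staple (toSphereConfig U) x i) = stapleSU2 U x i`,
`actionThrough (toSphereConfig U) x i = actionThroughSU2 U x i`, `toSphereConfig (update U b V) = update … (su2SphereEquiv V)`,
`½ Re tr(U_b S_b) = Σ_{k ≠ i} [½ Re tr P_{ik}(x) + ½ Re tr P_{ik}(x − e_k)]`; §1 adds to the tree's quaternion-matrix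
model `QuantumLattice.SU2Haar.quatMatrix` (with `Geometry.GaugeTheory.SpinorAlgebraFour.quatMatrix_add∕_zero∕_star` and
`QuantumLattice.SU2HaarSmallBall.trace_quatMatrix_re` imported BY NAME): `quatMatrix_sum`, the complex trace `= 2 re`,
`Im q = 0 ⇔ quatMatrix q` Hermitian, and `Xᴴ = −X ∧ tr X = 0 ⇔ X = quatMatrix ξ` with `re ξ = 0` (`𝔰𝔲(2) = quatMatrix (Im ℍ)`).

HONEST FRAMING. Junction lemmas about ONE lattice configuration; no measure, no effective action, no small-field
hypothesis; nothing of (JC), (S-E), (MP<L²)'s clauses, H1–H3 or of [Bałaban 1983–89] asserted or cited. NE7b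
(`T4WeightBudget.RelWeightBound`) NOT PRINTED and NOT PROVED; spine PROVED 0∕9; rung (B)+1 on a FINITE torus T⁴ — NOT
infinite volume, NOT the mass gap, NOT Clay. HONEST DEPENDENCY: continuum YM on T⁴ ⇐ BetaPertH ∧ nine spine estimates
(0/9 proved); BetaPertH ⇐ (D1) ∧ (D4) ∧ CAP+tail; G-an2-4 gates asym, D1 and NE2/3/4. POLICY: crux-route work under
`Spine/NE7b/` answering a referee open item on this lineage's module (FREEZE (0) respected: not a `T4Continuum/Support`
leaf); two concrete definitions (`stapleSU2`, `actionThroughSU2`), no `Prop`-valued fact, no `[cite:]` fact.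
-/

set_option autoImplicit false

noncomputable section

namespace Summit.QuantumFields.BalabanUV.T4Continuum.NE7b.SU2EulerLagrangeBridge

open scoped Quaternion Matrix
open Literature.MathematicalPhysics.QuantumFieldTheory (ZdEdge ZdGaugeConfig)
open Literature.Probability.LatticeModels (Site)
open Literature.MathematicalPhysics.QuantumLattice (quatMatrix su2Quat quatToSU2 quatMatrix_su2Quat quatMatrix_mul
  quatMatrix_neg quatMatrix_apply_00 quatMatrix_apply_01 quatMatrix_apply_10 quatMatrix_apply_11 continuousOn_quatToSU2
  trace_quatMatrix_re)
open Literature.Geometry.GaugeTheory (quatMatrix_add quatMatrix_zero quatMatrix_star)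
open Summit.QuantumFields.BalabanUV.T4Continuum.NE7b.CovariantDivergenceEL
  (covDiv staple stapleUp stapleDown re_mul_staple im_mul_staple critical_iff_covDiv_eq_zero staple_update)
open Summit.QuantumFields.BalabanUV.T4Continuum.NE7b.LinkMinimiserEL
  (actionThrough actionThrough_eq plaqReThrough_eq covDiv_eq_zero_of_forall_actionThrough_le
    covDiv_eq_zero_of_isLocalMin_actionThrough)
open Summit.QuantumFields.BalabanUV.T4Continuum.NE7b.SU2QuaternionBridge
  (su2SphereEquiv coe_su2SphereEquiv toSphereConfig re_trace_su2_eq_two_mul_re wilsonPlaquette_eq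
    coe_plaquette_toSphereConfig)

/-! ## §1 Complements on the quaternion model `quatMatrix : ℍ → M₂(ℂ)` -/

/-- `quatMatrix` of a finite sum. -/
theorem quatMatrix_sum {ι : Type*} (s : Finset ι) (f : ι → ℍ) :
    quatMatrix (∑ k ∈ s, f k) = ∑ k ∈ s, quatMatrix (f k) := by
  classical
  refine Finset.induction_on s (by rw [Finset.sum_empty, Finset.sum_empty, quatMatrix_zero]) fun a s ha ih => ?_
  rw [Finset.sum_insert ha, Finset.sum_insert ha, quatMatrix_add, ih]

/-- `tr (quatMatrix q) = 2·re q`. -/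
theorem trace_quatMatrix (q : ℍ) : (quatMatrix q).trace = ((2 * q.re : ℝ) : ℂ) := by
  rw [Matrix.trace_fin_two, quatMatrix_apply_00, quatMatrix_apply_11]
  apply Complex.ext <;> simp [two_mul]

/-- **`Im q = 0 ⇔ quatMatrix q` is Hermitian** (`(quatMatrix q)ᴴ = quatMatrix q̄`, `SpinorAlgebraFour.quatMatrix_star`;
entries `(0,0)`, `(0,1)` read off `imI = imJ = imK = 0`). -/
theorem im_eq_zero_iff_isHermitian (q : ℍ) : q.im = 0 ↔ (quatMatrix q).IsHermitian := by
  rw [Matrix.IsHermitian, ← quatMatrix_star]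
  constructor
  · intro h
    have hI : q.imI = 0 := by simpa using congrArg (fun r : ℍ => r.imI) h
    have hJ : q.imJ = 0 := by simpa using congrArg (fun r : ℍ => r.imJ) h
    have hK : q.imK = 0 := by simpa using congrArg (fun r : ℍ => r.imK) h
    have hs : star q = q := by ext <;> simp [hI, hJ, hK]
    rw [hs]
  · intro h
    have h00 := congrFun (congrFun h 0) 0
    have h01 := congrFun (congrFun h 0) 1
    rw [quatMatrix_apply_00, quatMatrix_apply_00, Complex.ext_iff] at h00
    rw [quatMatrix_apply_01, quatMatrix_apply_01, Complex.ext_iff] at h01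
    simp only [Quaternion.re_star, Quaternion.imI_star, Quaternion.imJ_star, Quaternion.imK_star] at h00 h01
    have hI : q.imI = 0 := by linarith [h00.2]
    have hJ : q.imJ = 0 := by linarith [h01.1]
    have hK : q.imK = 0 := by linarith [h01.2]
    ext <;> simp [hI, hJ, hK]

/-- A pure-imaginary quaternion gives a traceless skew-Hermitian matrix (an element of `𝔰𝔲(2)`). -/
theorem quatMatrix_skewHermitian_of_re_eq_zero {ξ : ℍ} (hξ : ξ.re = 0) :
    (quatMatrix ξ)ᴴ = -quatMatrix ξ ∧ (quatMatrix ξ).trace = 0 := by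
  refine ⟨?_, ?_⟩
  · rw [← quatMatrix_star, ← quatMatrix_neg, Quaternion.star_eq_neg.mpr hξ]
  · rw [trace_quatMatrix, hξ, mul_zero, Complex.ofReal_zero]

/-- **`𝔰𝔲(2) = quatMatrix (Im ℍ)`**: a traceless skew-Hermitian `2 × 2` complex matrix is `quatMatrix ξ` for a
(unique) pure-imaginary quaternion `ξ`. -/
theorem exists_eq_quatMatrix_of_skewHermitian {X : Matrix (Fin 2) (Fin 2) ℂ} (hX : Xᴴ = -X) (htr : X.trace = 0) :
    ∃ ξ : ℍ, ξ.re = 0 ∧ quatMatrix ξ = X := by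
  have h00 := congrFun (congrFun hX 0) 0
  have h10 := congrFun (congrFun hX 1) 0
  rw [Matrix.conjTranspose_apply, Matrix.neg_apply, Complex.ext_iff] at h00 h10
  simp only [Complex.star_def, Complex.conj_re, Complex.conj_im, Complex.neg_re, Complex.neg_im] at h00 h10
  rw [Matrix.trace_fin_two, Complex.ext_iff] at htr
  simp only [Complex.add_re, Complex.add_im, Complex.zero_re, Complex.zero_im] at htr
  refine ⟨⟨0, (X 0 0).im, (X 0 1).re, (X 0 1).im⟩, rfl, ?_⟩
  ext i j
  fin_cases i <;> fin_cases j <;> apply Complex.ext <;> simp [quatMatrix] <;> linarith [h00.1, h10.1, h10.2, htr.1, htr.2]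

/-! ## §2 The `SU(2)` staple sum and the Wilson action through a link; the dictionary -/

variable {d : ℕ}

/-- **The `SU(2)` matrix staple sum of the link `(x,i)`**: `Σ_{k ≠ i} [U(x+eᵢ,k)·U(x+e_k,i)⁻¹·U(x,k)⁻¹ +
U(x+eᵢ−e_k,k)⁻¹·U(x−e_k,i)⁻¹·U(x−e_k,k)]` (upper + lower staple in every plane `(i,k)`), as a `2 × 2` complex matrix.
It does not involve `U(x,i)` (`stapleSU2_update`); `½ Re tr(U(x,i)·S) = Σ_{k ≠ i} [½ Re tr P_{ik}(x) + ½ Re tr P_{ik}(x−e_k)]`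
(`re_trace_link_mul_stapleSU2`). -/
def stapleSU2 (U : ZdGaugeConfig d (Matrix.specialUnitaryGroup (Fin 2) ℂ)) (x : Site d) (i : Fin d) : Matrix (Fin 2) (Fin 2) ℂ :=
  ∑ k ∈ Finset.univ.erase i,
    ((((U (x + Pi.single i 1, k) * (U (x + Pi.single k 1, i))⁻¹ * (U (x, k))⁻¹ : Matrix.specialUnitaryGroup (Fin 2) ℂ)) : Matrix (Fin 2) (Fin 2) ℂ) +
      ((((U (x + Pi.single i 1 - Pi.single k 1, k))⁻¹ * (U (x - Pi.single k 1, i))⁻¹ * U (x - Pi.single k 1, k) : Matrix.specialUnitaryGroup (Fin 2) ℂ)) :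
        Matrix (Fin 2) (Fin 2) ℂ))

/-- **The `SU(2)` Wilson action of the plaquettes through the link `(x,i)`**:
`Σ_{k ≠ i} [(1 − ½ Re tr P_{ik}(x)) + (1 − ½ Re tr P_{ik}(x − e_k))]` — the only part of the Wilson action
`Σ_p (1 − ½ Re tr U(∂p))` that depends on the link variable `U(x,i)`. -/
def actionThroughSU2 (U : ZdGaugeConfig d (Matrix.specialUnitaryGroup (Fin 2) ℂ)) (x : Site d) (i : Fin d) : ℝ :=
  ∑ k ∈ Finset.univ.erase i,
    ((1 - (1 / 2 : ℝ) * (((ZdGaugeConfig.plaquette U x i k : Matrix.specialUnitaryGroup (Fin 2) ℂ) : Matrix (Fin 2) (Fin 2) ℂ).trace).re) +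
      (1 - (1 / 2 : ℝ) * (((ZdGaugeConfig.plaquette U (x - Pi.single k 1) i k : Matrix.specialUnitaryGroup (Fin 2) ℂ) : Matrix (Fin 2) (Fin 2) ℂ).trace).re))

/-- The transported link variable, as a quaternion, is `su2Quat` of the `SU(2)` link variable. -/
theorem coe_toSphereConfig (U : ZdGaugeConfig d (Matrix.specialUnitaryGroup (Fin 2) ℂ)) (b : ZdEdge d) :
    ((toSphereConfig U b : Metric.sphere (0 : ℍ) 1) : ℍ) = su2Quat (U b) := rfl

/-- … hence its matrix is the `SU(2)` link variable itself. -/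
theorem quatMatrix_coe_toSphereConfig (U : ZdGaugeConfig d (Matrix.specialUnitaryGroup (Fin 2) ℂ)) (b : ZdEdge d) :
    quatMatrix ((toSphereConfig U b : Metric.sphere (0 : ℍ) 1) : ℍ) = ((U b : Matrix.specialUnitaryGroup (Fin 2) ℂ) : Matrix (Fin 2) (Fin 2) ℂ) := by
  rw [coe_toSphereConfig, quatMatrix_su2Quat]

/-- The matrix of (the quaternion of) `su2SphereEquiv g` is `g`. -/
theorem quatMatrix_coe_su2SphereEquiv (g : Matrix.specialUnitaryGroup (Fin 2) ℂ) :
    quatMatrix ((su2SphereEquiv g : Metric.sphere (0 : ℍ) 1) : ℍ) = (g : Matrix (Fin 2) (Fin 2) ℂ) := by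
  rw [coe_su2SphereEquiv, quatMatrix_su2Quat]

/-- Upper staples correspond under `su2SphereEquiv` (it is a group homomorphism). -/
theorem stapleUp_toSphereConfig (U : ZdGaugeConfig d (Matrix.specialUnitaryGroup (Fin 2) ℂ)) (x : Site d) (i k : Fin d) :
    stapleUp (toSphereConfig U) x i k =
      su2SphereEquiv (U (x + Pi.single i 1, k) * (U (x + Pi.single k 1, i))⁻¹ * (U (x, k))⁻¹) := by
  simp only [stapleUp, toSphereConfig, map_mul, map_inv]

/-- Lower staples correspond under `su2SphereEquiv`. -/
theorem stapleDown_toSphereConfig (U : ZdGaugeConfig d (Matrix.specialUnitaryGroup (Fin 2) ℂ)) (x : Site d) (i k : Fin d) :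
    stapleDown (toSphereConfig U) x i k =
      su2SphereEquiv ((U (x + Pi.single i 1 - Pi.single k 1, k))⁻¹ * (U (x - Pi.single k 1, i))⁻¹ *
        U (x - Pi.single k 1, k)) := by
  simp only [stapleDown, toSphereConfig, map_mul, map_inv]

/-- **STAPLES CORRESPOND**: the matrix of the quaternion staple sum of the transported configuration is the `SU(2)`
matrix staple sum. -/
theorem quatMatrix_staple_toSphereConfig (U : ZdGaugeConfig d (Matrix.specialUnitaryGroup (Fin 2) ℂ)) (x : Site d) (i : Fin d) :
    quatMatrix (staple (toSphereConfig U) x i) = stapleSU2 U x i := by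
  rw [staple, quatMatrix_sum, stapleSU2]
  refine Finset.sum_congr rfl fun k _ => ?_
  rw [quatMatrix_add, stapleUp_toSphereConfig, stapleDown_toSphereConfig, quatMatrix_coe_su2SphereEquiv,
    quatMatrix_coe_su2SphereEquiv]

/-- `U(x,i)·S_{SU2}(x,i)` is the matrix of the quaternion `q_{(x,i)}·S(x,i)` of the transported configuration. -/
theorem link_mul_stapleSU2 (U : ZdGaugeConfig d (Matrix.specialUnitaryGroup (Fin 2) ℂ)) (x : Site d) (i : Fin d) :
    ((U (x, i) : Matrix.specialUnitaryGroup (Fin 2) ℂ) : Matrix (Fin 2) (Fin 2) ℂ) * stapleSU2 U x i =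
      quatMatrix (((toSphereConfig U (x, i) : Metric.sphere (0 : ℍ) 1) : ℍ) * staple (toSphereConfig U) x i) := by
  rw [quatMatrix_mul, quatMatrix_coe_toSphereConfig, quatMatrix_staple_toSphereConfig]

/-- **THE WILSON FUNCTIONAL THROUGH A LINK, `SU(2)` READING** of `CovariantDivergenceEL.re_mul_staple`:
`Re tr(U(x,i)·S_{SU2}(x,i)) = Σ_{k ≠ i} [Re tr P_{ik}(x) + Re tr P_{ik}(x − e_k)]`. -/
theorem re_trace_link_mul_stapleSU2 (U : ZdGaugeConfig d (Matrix.specialUnitaryGroup (Fin 2) ℂ)) (x : Site d) (i : Fin d) :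
    ((((U (x, i) : Matrix.specialUnitaryGroup (Fin 2) ℂ) : Matrix (Fin 2) (Fin 2) ℂ) * stapleSU2 U x i).trace).re =
      ∑ k ∈ Finset.univ.erase i,
        ((((ZdGaugeConfig.plaquette U x i k : Matrix.specialUnitaryGroup (Fin 2) ℂ) : Matrix (Fin 2) (Fin 2) ℂ).trace).re +
          (((ZdGaugeConfig.plaquette U (x - Pi.single k 1) i k : Matrix.specialUnitaryGroup (Fin 2) ℂ) : Matrix (Fin 2) (Fin 2) ℂ).trace).re) := by
  rw [link_mul_stapleSU2, trace_quatMatrix_re, re_mul_staple, Finset.mul_sum]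
  refine Finset.sum_congr rfl fun k _ => ?_
  rw [coe_plaquette_toSphereConfig, coe_plaquette_toSphereConfig, re_trace_su2_eq_two_mul_re,
    re_trace_su2_eq_two_mul_re]
  ring

/-- **THE WILSON ACTION THROUGH A LINK IN BOTH LANGUAGES**: `actionThrough (toSphereConfig U) x i = actionThroughSU2 U x i`
(leaf-05's `LinkMinimiserEL.actionThrough` BY NAME; plaquette by plaquette `SU2QuaternionBridge.wilsonPlaquette_eq`). -/
theorem actionThrough_toSphereConfig (U : ZdGaugeConfig d (Matrix.specialUnitaryGroup (Fin 2) ℂ)) (x : Site d) (i : Fin d) :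
    actionThrough (toSphereConfig U) x i = actionThroughSU2 U x i := by
  unfold actionThrough actionThroughSU2
  refine Finset.sum_congr rfl fun k _ => ?_
  rw [← wilsonPlaquette_eq, ← wilsonPlaquette_eq]

/-- `actionThroughSU2 = 2·#{k ≠ i} − ½ Re tr(U(x,i)·S_{SU2}(x,i))`. -/
theorem actionThroughSU2_eq (U : ZdGaugeConfig d (Matrix.specialUnitaryGroup (Fin 2) ℂ)) (x : Site d) (i : Fin d) :
    actionThroughSU2 U x i =
      2 * ((Finset.univ.erase i).card : ℝ) -
        (1 / 2 : ℝ) * ((((U (x, i) : Matrix.specialUnitaryGroup (Fin 2) ℂ) : Matrix (Fin 2) (Fin 2) ℂ) * stapleSU2 U x i).trace).re := by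
  rw [← actionThrough_toSphereConfig, actionThrough_eq, plaqReThrough_eq, link_mul_stapleSU2, trace_quatMatrix_re]
  ring

/-- **TRANSPORT COMMUTES WITH UPDATING A LINK**: `toSphereConfig (U with U b := V) = (toSphereConfig U) with b := su2SphereEquiv V`. -/
theorem toSphereConfig_update (U : ZdGaugeConfig d (Matrix.specialUnitaryGroup (Fin 2) ℂ)) (b : ZdEdge d) (V : Matrix.specialUnitaryGroup (Fin 2) ℂ) :
    toSphereConfig (Function.update U b V) = Function.update (toSphereConfig U) b (su2SphereEquiv V) := by
  funext b'
  rcases eq_or_ne b' b with rfl | h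
  · simp only [toSphereConfig, Function.update_self]
  · simp only [toSphereConfig, Function.update_of_ne h]

/-- The `SU(2)` staple sum does not involve the link variable `U(x,i)` (`CovariantDivergenceEL.staple_update` read
through `quatMatrix`). -/
theorem stapleSU2_update (U : ZdGaugeConfig d (Matrix.specialUnitaryGroup (Fin 2) ℂ)) (x : Site d) (i : Fin d) (V : Matrix.specialUnitaryGroup (Fin 2) ℂ) :
    stapleSU2 (Function.update U (x, i) V) x i = stapleSU2 U x i := by
  rw [← quatMatrix_staple_toSphereConfig, ← quatMatrix_staple_toSphereConfig, toSphereConfig_update, staple_update]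

/-- **THE ONE-LINK VARIATIONAL PROBLEM IN CLOSED FORM**: with the link set to `V` (the other links frozen),
`actionThroughSU2 = 2·#{k ≠ i} − ½ Re tr(V·S_{SU2}(x,i))`. -/
theorem actionThroughSU2_update (U : ZdGaugeConfig d (Matrix.specialUnitaryGroup (Fin 2) ℂ)) (x : Site d) (i : Fin d) (V : Matrix.specialUnitaryGroup (Fin 2) ℂ) :
    actionThroughSU2 (Function.update U (x, i) V) x i =
      2 * ((Finset.univ.erase i).card : ℝ) -
        (1 / 2 : ℝ) * (((V : Matrix (Fin 2) (Fin 2) ℂ) * stapleSU2 U x i).trace).re := by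
  rw [actionThroughSU2_eq, stapleSU2_update, Function.update_self]

/-! ## §3 THE BRIDGE: `covDiv (toSphereConfig U) x i = 0` ⇔ the `SU(2)` lattice Yang–Mills equation at `(x,i)` -/

/-- **OI-61, MATRIX FORM.** For an `SU(2)` configuration `U` and a link `b = (x,i)` with matrix staple sum
`S_b = stapleSU2 U x i`: the covariant divergence of the sine-curvature of the transported configuration vanishes at
`b` iff `U_b·S_b` is HERMITIAN, `(U_b S_b)ᴴ = U_b S_b` — the lattice Yang–Mills (Euler–Lagrange) equation of the Wilson
action at the link in `SU(2)` matrix language (`U_b S_b` lies in the real span of `SU(2)` = `quatMatrix ℍ`, where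
«antihermitian part = 0» is «imaginary part = 0», `CovariantDivergenceEL.im_mul_staple`). -/
theorem covDiv_toSphereConfig_eq_zero_iff_isHermitian (U : ZdGaugeConfig d (Matrix.specialUnitaryGroup (Fin 2) ℂ)) (x : Site d) (i : Fin d) :
    covDiv (toSphereConfig U) x i = 0 ↔
      ((((U (x, i) : Matrix.specialUnitaryGroup (Fin 2) ℂ) : Matrix (Fin 2) (Fin 2) ℂ) * stapleSU2 U x i)).IsHermitian := by
  rw [← im_mul_staple, im_eq_zero_iff_isHermitian, link_mul_stapleSU2]

/-- **OI-61, TANGENT FORM.** `covDiv (toSphereConfig U) x i = 0` iff the first variation of `V ↦ Re tr(V·S_b)` at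
`V = U_b` vanishes along every direction `X·U_b`, `X ∈ 𝔰𝔲(2)` (traceless skew-Hermitian): `Re tr(X·U_b·S_b) = 0` —
`CovariantDivergenceEL.critical_iff_covDiv_eq_zero` (tangent directions `ξ·q_b`, `re ξ = 0`, of `S³`) read through
`𝔰𝔲(2) = quatMatrix (Im ℍ)`. By `actionThroughSU2_update`, `Re tr(V·S_b)` is `−2·actionThroughSU2 + const`, so this is
criticality of the one-link Wilson action on the group. -/
theorem covDiv_toSphereConfig_eq_zero_iff_tangent (U : ZdGaugeConfig d (Matrix.specialUnitaryGroup (Fin 2) ℂ)) (x : Site d) (i : Fin d) :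
    covDiv (toSphereConfig U) x i = 0 ↔
      ∀ X : Matrix (Fin 2) (Fin 2) ℂ, Xᴴ = -X → X.trace = 0 →
        ((X * ((U (x, i) : Matrix.specialUnitaryGroup (Fin 2) ℂ) : Matrix (Fin 2) (Fin 2) ℂ) * stapleSU2 U x i).trace).re = 0 := by
  rw [← critical_iff_covDiv_eq_zero]
  constructor
  · intro h X hX htr
    obtain ⟨ξ, hξ, rfl⟩ := exists_eq_quatMatrix_of_skewHermitian hX htr
    rw [Matrix.mul_assoc, link_mul_stapleSU2, ← quatMatrix_mul, trace_quatMatrix_re, ← mul_assoc, h ξ hξ, mul_zero]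
  · intro h ξ hξ
    have h1 := h (quatMatrix ξ) (quatMatrix_skewHermitian_of_re_eq_zero hξ).1 (quatMatrix_skewHermitian_of_re_eq_zero hξ).2
    rw [Matrix.mul_assoc, link_mul_stapleSU2, ← quatMatrix_mul, trace_quatMatrix_re, ← mul_assoc] at h1
    linarith

/-! ## §4 Minimisers of the `SU(2)` Wilson action through a link satisfy the equation -/

/-- **GLOBAL ONE-LINK MINIMISER (`SU(2)`) ⇒ LATTICE YANG–MILLS EQUATION AT THE LINK.** If no value `V ∈ SU(2)` of the
link variable `U(x,i)` (the other links frozen) lowers the Wilson action of the plaquettes through the link — in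
particular if `U` minimises the `SU(2)` Wilson action over any set of free links containing `(x,i)`, the rest frozen —
then `covDiv (toSphereConfig U) x i = 0` (leaf-05's `covDiv_eq_zero_of_forall_actionThrough_le` through the bijection
`su2SphereEquiv`). This is the form in which route R-H's references (action minimisers with the hole's links free)
meet the criticality hypothesis `hcrit` of `EnergyDichotomySU2.dichotomy_su2(_dist1)`. -/
theorem covDiv_toSphereConfig_eq_zero_of_forall_actionThroughSU2_le (U : ZdGaugeConfig d (Matrix.specialUnitaryGroup (Fin 2) ℂ)) (x : Site d) (i : Fin d)
    (hmin : ∀ V : Matrix.specialUnitaryGroup (Fin 2) ℂ, actionThroughSU2 U x i ≤ actionThroughSU2 (Function.update U (x, i) V) x i) :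
    covDiv (toSphereConfig U) x i = 0 := by
  refine (covDiv_eq_zero_of_forall_actionThrough_le (toSphereConfig U) x i fun W => ?_).1
  obtain ⟨V, rfl⟩ := su2SphereEquiv.surjective W
  rw [← toSphereConfig_update, actionThrough_toSphereConfig, actionThrough_toSphereConfig]
  exact hmin V

/-- `su2SphereEquiv : SU(2) → S³` is continuous (its components are real and imaginary parts of matrix entries). -/
theorem continuous_su2SphereEquiv : Continuous (su2SphereEquiv : Matrix.specialUnitaryGroup (Fin 2) ℂ → Metric.sphere (0 : ℍ) 1) := by
  have hc : Continuous fun U : Matrix.specialUnitaryGroup (Fin 2) ℂ => (U : Matrix (Fin 2) (Fin 2) ℂ) := continuous_subtype_val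
  have h00re : Continuous fun U : Matrix.specialUnitaryGroup (Fin 2) ℂ => ((U : Matrix (Fin 2) (Fin 2) ℂ) 0 0).re :=
    Complex.continuous_re.comp (hc.matrix_elem 0 0)
  have h00im : Continuous fun U : Matrix.specialUnitaryGroup (Fin 2) ℂ => ((U : Matrix (Fin 2) (Fin 2) ℂ) 0 0).im :=
    Complex.continuous_im.comp (hc.matrix_elem 0 0)
  have h01re : Continuous fun U : Matrix.specialUnitaryGroup (Fin 2) ℂ => ((U : Matrix (Fin 2) (Fin 2) ℂ) 0 1).re :=
    Complex.continuous_re.comp (hc.matrix_elem 0 1)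
  have h01im : Continuous fun U : Matrix.specialUnitaryGroup (Fin 2) ℂ => ((U : Matrix (Fin 2) (Fin 2) ℂ) 0 1).im :=
    Complex.continuous_im.comp (hc.matrix_elem 0 1)
  have hq : Continuous fun U : Matrix.specialUnitaryGroup (Fin 2) ℂ => su2Quat U := by
    have hrepr : (fun U : Matrix.specialUnitaryGroup (Fin 2) ℂ => su2Quat U) = fun U : Matrix.specialUnitaryGroup (Fin 2) ℂ =>
        (((U : Matrix (Fin 2) (Fin 2) ℂ) 0 0).re : ℍ) +
          ((U : Matrix (Fin 2) (Fin 2) ℂ) 0 0).im • (id ⟨0, 1, 0, 0⟩ : ℍ) +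
          ((U : Matrix (Fin 2) (Fin 2) ℂ) 0 1).re • (id ⟨0, 0, 1, 0⟩ : ℍ) +
          ((U : Matrix (Fin 2) (Fin 2) ℂ) 0 1).im • (id ⟨0, 0, 0, 1⟩ : ℍ) := by
      funext U
      ext <;> simp [su2Quat]
    rw [hrepr]
    exact (((Quaternion.continuous_coe.comp h00re).add (h00im.smul continuous_const)).add
      (h01re.smul continuous_const)).add (h01im.smul continuous_const)
  exact Continuous.subtype_mk hq _

/-- `su2SphereEquiv.symm : S³ → SU(2)` is continuous (it is `quatToSU2`, continuous away from `0`). Hence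
`su2SphereEquiv` is a homeomorphism of the two compact groups. -/
theorem continuous_su2SphereEquiv_symm : Continuous (su2SphereEquiv.symm : Metric.sphere (0 : ℍ) 1 → Matrix.specialUnitaryGroup (Fin 2) ℂ) := by
  have h : Continuous fun q : Metric.sphere (0 : ℍ) 1 => quatToSU2 (q : ℍ) :=
    continuousOn_quatToSU2.comp_continuous continuous_subtype_val fun q => ne_zero_of_mem_unit_sphere q
  exact h

/-- **LOCAL ONE-LINK MINIMISER (`SU(2)`) ⇒ LATTICE YANG–MILLS EQUATION AT THE LINK.** If the link value `U(x,i)` is a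
LOCAL minimiser, on the topological group `SU(2)`, of `V ↦` the Wilson action of the plaquettes through the link with
the link set to `V` (the other links frozen), then `covDiv (toSphereConfig U) x i = 0` — leaf-05's
`covDiv_eq_zero_of_isLocalMin_actionThrough` (great-circle first variation on `S³`) transported along the
homeomorphism `su2SphereEquiv`. -/
theorem covDiv_toSphereConfig_eq_zero_of_isLocalMin (U : ZdGaugeConfig d (Matrix.specialUnitaryGroup (Fin 2) ℂ)) (x : Site d) (i : Fin d)
    (hmin : IsLocalMin (fun V : Matrix.specialUnitaryGroup (Fin 2) ℂ => actionThroughSU2 (Function.update U (x, i) V) x i) (U (x, i))) :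
    covDiv (toSphereConfig U) x i = 0 := by
  apply covDiv_eq_zero_of_isLocalMin_actionThrough (toSphereConfig U) x i
  have key : (fun W : Metric.sphere (0 : ℍ) 1 => actionThrough (Function.update (toSphereConfig U) (x, i) W) x i) =
      (fun V : Matrix.specialUnitaryGroup (Fin 2) ℂ => actionThroughSU2 (Function.update U (x, i) V) x i) ∘ su2SphereEquiv.symm := by
    funext W
    simp only [Function.comp_apply]
    rw [← actionThrough_toSphereConfig, toSphereConfig_update, MulEquiv.apply_symm_apply]
  have h0 : toSphereConfig U (x, i) = su2SphereEquiv (U (x, i)) := rfl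
  rw [key, h0]
  refine IsLocalMin.comp_continuous ?_ continuous_su2SphereEquiv_symm.continuousAt
  rw [MulEquiv.symm_apply_apply]
  exact hmin

/-- The converse bookkeeping for consumers holding the quaternion-side statement: criticality of the transported
configuration in the chain's sense gives the `SU(2)` matrix equation `(U_b S_b)ᴴ = U_b S_b` at the link. -/
theorem isHermitian_link_mul_stapleSU2_of_covDiv_eq_zero (U : ZdGaugeConfig d (Matrix.specialUnitaryGroup (Fin 2) ℂ)) (x : Site d) (i : Fin d)
    (h : covDiv (toSphereConfig U) x i = 0) :
    ((((U (x, i) : Matrix.specialUnitaryGroup (Fin 2) ℂ) : Matrix (Fin 2) (Fin 2) ℂ) * stapleSU2 U x i)).IsHermitian :=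
  (covDiv_toSphereConfig_eq_zero_iff_isHermitian U x i).1 h

end Summit.QuantumFields.BalabanUV.T4Continuum.NE7b.SU2EulerLagrangeBridge

end
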